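import Summits.NavierStokesRegularity.NavierStokesRegularity.Theses.QuantisedSymmetry
import Summits.NavierStokesRegularity.NavierStokesRegularity.Theses.Blowup
import Summits.NavierStokesRegularity.NavierStokesRegularity.Theses.DssFarFieldSlaving
import Summits.NavierStokesRegularity.NavierStokesRegularity.Theorems.QuantisedSymmetryPolyhedralDssProfileExistsDominatesBlowupProfile
import Summits.NavierStokesRegularity.NavierStokesRegularity.Theorems.DssFarFieldSlavingDssTruncationBridge
import Summits.NavierStokesRegularity.NavierStokesRegularity.Theorems.QuantisedSymmetryLiouvilleKillsProfile
import Literature.Analysis.FluidPDE.SelfSimilar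
import Literature.Analysis.FluidPDE.SelfSimilarLiouville
import Literature.Analysis.FluidPDE.MildSolution
import Literature.Analysis.FluidPDE.VectorCalculus
import Literature.Analysis.FluidPDE.AncientMildCompactnessForced
import HarnessLib

/-!
# Strategist sketch `s14-g3` for crux `PolyhedralDssProfileExists` (stmt-NavierStokesRegularity-1404)

Companion to `STRATEGY-CENSUS-s14.md` (second, independent census, family `s`, gen 3).  Every
declaration below is either a DEFINITION typing an attempted strategy, or a sorry-free theorem
recording why the attempt gives no leverage on the crux.  Nothing here is a registered stub.

* §1  the crux split into its symmetry data `IsPolyhedralGroup` and analytic data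
      `IsTypeIDssProfileFor` (`crux_iff`).
* §2  WEAKER INTERMEDIATE.  `weaker_of_crux` / `weaker_decides`: the crux implies the open item
      `Blowup.BlowupTypeIDssProfile` (stmt-0155) and that item ALREADY decides `¬ NavierStokesRegularity`
      through landed theorems — so the polyhedral clauses of the crux are load-bearing nowhere in the
      tree; the re-glue is a ROUTE edit (tenure), not a line on this crux, and 0155 is itself a bare
      existence statement with the same single-∃-stub skeleton.
* §3  DECOMPOSITION D-A (best typed split): `ForcedPolyhedralApproxFamily` (∃-piece) +
      `LimitLemma` (compactness, KNSS Lemma 6.1 with vanishing forcing =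
      `Literature.Analysis.FluidPDE.exists_oseenMild_limit_of_forced`).  The seam `crux_of_pieces` is
      modus ponens; `approxFamily_of_crux` PROVES the ∃-piece from the crux (force `f = 0`), so the
      ∃-piece is the whole crux again (costume), exactly the defect of `Lines/birth.lean` and
      `Lines/polyhedral_cell.lean`.
* §4  STRENGTHEN.  `PinnedProfileExists` (prescribed group and factor window) trivially implies the
      crux (`crux_of_pinned`); the rigid strengthenings with an engine are refuted in tree (steady:
      `tsai_selfsimilar_holds`; `c` near `1`: Chae–Wolf; axisymmetric: KNSS) — see the census.
* §5  NEGATION.  `PolyhedralTypeIDssLiouville ↔ ¬ crux` (`liouville_iff_not_crux`); it is implied by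
      the route's kill switch item 1405 (`dssLiouville_of_killSwitch`).  `EquivariantBeltramiZeroExists`
      types the obstruction found for the even-map / sphere-degree hunt: the bilinear self-similar
      Duhamel form has nontrivial zeros (G-equivariant Beltrami fields), so `Q/‖Q‖` is undefined.
-/

namespace Summit.NavierStokesRegularity.NavierStokesRegularity.Cruxes.PolyhedralDssProfileExists.StrategistS14g3

open MeasureTheory Set Function Filter Topology
open Literature.Analysis.FluidPDE
open _root_.Summit.NavierStokesRegularity.NavierStokesRegularity.Theses

/-- `ℝ³` as in the route file. -/
abbrev E3 : Type := EuclideanSpace ℝ (Fin 3)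

/-! ## §1 The crux, factored -/

/-- The symmetry clauses of the crux: `G` finite, orientation preserving, with no invariant line or
plane (an irreducible finite rotation group: chiral tetrahedral / octahedral / icosahedral). -/
def IsPolyhedralGroup (G : Subgroup (E3 ≃ₗᵢ[ℝ] E3)) : Prop :=
  Finite G ∧ (∀ g ∈ G, LinearMap.det (g.toLinearEquiv : E3 →ₗ[ℝ] E3) = 1) ∧
    ∀ V : Submodule ℝ E3, (∀ g ∈ G, ∀ v ∈ V, g v ∈ V) → V = ⊥ ∨ V = ⊤

/-- The analytic clauses of the crux for a fixed group `G` and factor `c`: an ancient mild (`ν = 1`)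
solution with measurable slices, `c`-DSS, Type-I bounded, `G`-equivariant, not a.e. trivial. -/
def IsTypeIDssProfileFor (G : Subgroup (E3 ≃ₗᵢ[ℝ] E3)) (c : ℝ) (u : ℝ → E3 → E3) : Prop :=
  IsAncientMildSolution 1 u ∧ (∀ t < 0, AEStronglyMeasurable (u t) volume) ∧
    IsDiscretelySelfSimilar c u ∧ (∃ C₀ : ℝ, HasTypeIDecay C₀ u) ∧
    (∀ g ∈ G, ∀ t x, u t (g x) = g (u t x)) ∧ ¬ (∀ t < 0, u t =ᵐ[volume] 0)

/-- The crux is `∃ G polyhedral, ∃ c > 1, ∃ u, IsTypeIDssProfileFor G c u`. -/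
theorem crux_iff :
    QuantisedSymmetry.PolyhedralDssProfileExists ↔
      ∃ G, IsPolyhedralGroup G ∧ ∃ c : ℝ, 1 < c ∧ ∃ u, IsTypeIDssProfileFor G c u := by
  constructor
  · rintro ⟨G, hfin, hdet, hirr, c, hc, u, hu⟩
    exact ⟨G, ⟨hfin, hdet, hirr⟩, c, hc, u, hu⟩
  · rintro ⟨G, ⟨hfin, hdet, hirr⟩, c, hc, u, hu⟩
    exact ⟨G, hfin, hdet, hirr, c, hc, u, hu⟩

/-! ## §2 Weaker intermediate: the crux is only used through `BlowupTypeIDssProfile` -/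

/-- The crux implies the (conjecturally strictly) weaker open item `Blowup.BlowupTypeIDssProfile`
(stmt-NavierStokesRegularity-0155): landed as `stub_dominatesBlowupProfile`. -/
theorem weaker_of_crux :
    QuantisedSymmetry.PolyhedralDssProfileExists → Blowup.BlowupTypeIDssProfile :=
  _root_.Summit.NavierStokesRegularity.NavierStokesRegularity.Theorems.PolyhedralDssProfileExists.PolyhedralCell.stub_dominatesBlowupProfile

/-- … and that weaker item ALREADY decides the sub-problem through landed theorems (route
`DssFarFieldSlaving`: `closes` with its bridge `DssTruncationBridge` proved). Hence the polyhedral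
symmetry of the crux is load-bearing in no deciding theorem of the tree. -/
theorem weaker_decides : Blowup.BlowupTypeIDssProfile → ¬ _root_.NavierStokesRegularity := fun hW =>
  DssFarFieldSlaving.closes
    _root_.Summit.NavierStokesRegularity.NavierStokesRegularity.Theorems.dssTruncationBridge_proof hW

/-- The route's own deciding chain factors through the weaker item. -/
theorem crux_decides_via_weaker :
    QuantisedSymmetry.PolyhedralDssProfileExists → ¬ _root_.NavierStokesRegularity := fun hX =>
  weaker_decides (weaker_of_crux hX)

/-! ## §3 Decomposition D-A: forced approximants + compactness -/

/-- Piece A1 (the ∃-piece): a family of `G`-equivariant, `c`-DSS, Type-I bounded ancient mild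
solutions of the FORCED system with DSS-invariant forces of Type-I size `ε → 0`, factors in a fixed
window `[cLo, cHi] ⊂ (1, ∞)`, a uniform Type-I constant `K`, and a uniform amplitude floor `ε₁` at
some point of the backward slab (the floor survives locally uniform limits; the Type-I bound and DSS
keep the floor point in a compact region modulo rescaling). -/
def ForcedPolyhedralApproxFamily : Prop :=
  ∃ G : Subgroup (E3 ≃ₗᵢ[ℝ] E3), IsPolyhedralGroup G ∧
    ∃ cLo cHi K ε₁ : ℝ, 1 < cLo ∧ cLo ≤ cHi ∧ 0 < ε₁ ∧
      ∀ ε : ℝ, 0 < ε → ∃ c : ℝ, cLo ≤ c ∧ c ≤ cHi ∧ ∃ u f : ℝ → E3 → E3,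
        (∀ t < 0, IsWeaklyDivFree (u t)) ∧
        (∀ s t : ℝ, s < t → t < 0 → IsMildNSSolutionBetween 1 f u s t) ∧
        (∀ t < 0, AEStronglyMeasurable (u t) volume) ∧
        IsDiscretelySelfSimilar c u ∧ nsRescaleForce c f = f ∧ HasTypeIDecay K u ∧
        (∀ t < 0, ∀ x, ‖f t x‖ ≤ ε / (‖x‖ + Real.sqrt (-t)) ^ 3) ∧
        (∀ g ∈ G, ∀ t x, u t (g x) = g (u t x)) ∧
        ∃ t < 0, ∃ x, ε₁ ≤ Real.sqrt (-t) * ‖u t x‖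

/-- Piece A2 (the limit lemma, size L, provable): compactness of the family (KNSS 2009 Lemma 6.1
with vanishing forcing, `exists_oseenMild_limit_of_forced`, after the routine upgrade of tested-mild
Type-I fields to the pointwise Oseen identity), DSS with a subsequential factor `c ∈ [cLo, cHi]`,
`G`-equivariance and the amplitude floor pass to the limit. -/
def LimitLemma : Prop :=
  ForcedPolyhedralApproxFamily → QuantisedSymmetry.PolyhedralDssProfileExists

/-- The seam of split D-A (modus ponens). -/
theorem crux_of_pieces (h₁ : ForcedPolyhedralApproxFamily) (h₂ : LimitLemma) :
    QuantisedSymmetry.PolyhedralDssProfileExists :=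
  h₂ h₁

/-- COLLAPSE of split D-A: the ∃-piece is implied by the crux itself (take the constant family
`u_ε = u`, `f = 0`), so `ForcedPolyhedralApproxFamily ↔ crux` given the (true) limit lemma — the
piece that "remains the whole crux" is A1. -/
theorem approxFamily_of_crux (h : QuantisedSymmetry.PolyhedralDssProfileExists) :
    ForcedPolyhedralApproxFamily := by
  obtain ⟨G, hfin, hdet, hirr, c, hc, u, hanc, hmeas, hdss, ⟨C₀, hdec⟩, hequi, hnt⟩ := h
  obtain ⟨hdiv, hmild⟩ := hanc
  -- a point of the backward slab where `u` does not vanish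
  have hpt : ∃ t, t < 0 ∧ ∃ x, u t x ≠ 0 := by
    by_contra hcon
    push Not at hcon
    refine hnt fun t ht => ?_
    have h0 : u t = 0 := funext (hcon t ht)
    rw [h0]
  obtain ⟨t₀, ht₀, x₀, hx₀⟩ := hpt
  refine ⟨G, ⟨hfin, hdet, hirr⟩, c, c, C₀, Real.sqrt (-t₀) * ‖u t₀ x₀‖, hc, le_rfl, ?_, ?_⟩
  · exact mul_pos (Real.sqrt_pos.2 (by linarith)) (norm_pos_iff.2 hx₀)
  · intro ε hε
    refine ⟨c, le_rfl, le_rfl, u, 0, hdiv, hmild, hmeas, hdss, ?_, hdec, ?_, hequi,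
      t₀, ht₀, x₀, le_rfl⟩
    · funext t x
      simp [nsRescaleForce]
    · intro t ht x
      simp only [Pi.zero_apply, norm_zero]
      positivity

/-! ## §4 Strengthen: pinned data -/

/-- S⁺: the profile exists for a PRESCRIBED group `G₀` with factor in a PRESCRIBED window `(1, cHi]`
(what a certified numerical construction would deliver). -/
def PinnedProfileExists (G₀ : Subgroup (E3 ≃ₗᵢ[ℝ] E3)) (cHi : ℝ) : Prop :=
  ∃ c : ℝ, 1 < c ∧ c ≤ cHi ∧ ∃ u, IsTypeIDssProfileFor G₀ c u

/-- S⁺ gives the crux for any polyhedral `G₀` (routine); the added rigidity names no construction. -/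
theorem crux_of_pinned {G₀ : Subgroup (E3 ≃ₗᵢ[ℝ] E3)} {cHi : ℝ} (hG : IsPolyhedralGroup G₀)
    (h : PinnedProfileExists G₀ cHi) : QuantisedSymmetry.PolyhedralDssProfileExists := by
  obtain ⟨c, hc, -, u, hu⟩ := h
  exact crux_iff.2 ⟨G₀, hG, c, hc, u, hu⟩

/-! ## §5 Negation: the polyhedral Type-I DSS Liouville statement -/

/-- `¬ crux` as a Liouville theorem: every polyhedral-equivariant, `c`-DSS (`c > 1`), Type-I bounded
ancient mild solution with measurable slices is a.e. trivial.  Weaker than the route's kill switch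
`PolyhedralTypeILiouville` (item 1405, no DSS hypothesis) and than Tsai's wall `∀ c, TypeIDSSLiouville c`. -/
def PolyhedralTypeIDssLiouville : Prop :=
  ∀ G : Subgroup (E3 ≃ₗᵢ[ℝ] E3), IsPolyhedralGroup G → ∀ c : ℝ, 1 < c → ∀ u : ℝ → E3 → E3,
    IsAncientMildSolution 1 u → (∀ t < 0, AEStronglyMeasurable (u t) volume) →
      IsDiscretelySelfSimilar c u → (∃ C₀ : ℝ, HasTypeIDecay C₀ u) →
        (∀ g ∈ G, ∀ t x, u t (g x) = g (u t x)) → ∀ t < 0, u t =ᵐ[volume] 0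

/-- The Liouville statement is exactly the negation of the crux. -/
theorem liouville_iff_not_crux :
    PolyhedralTypeIDssLiouville ↔ ¬ QuantisedSymmetry.PolyhedralDssProfileExists := by
  constructor
  · rintro hL ⟨G, hfin, hdet, hirr, c, hc, u, hanc, hmeas, hdss, hdec, hequi, hnt⟩
    exact hnt (hL G ⟨hfin, hdet, hirr⟩ c hc u hanc hmeas hdss hdec hequi)
  · intro hN G hG c hc u hanc hmeas hdss hdec hequi
    by_contra hnt
    exact hN ⟨G, hG.1, hG.2.1, hG.2.2, c, hc, u, hanc, hmeas, hdss, hdec, hequi, hnt⟩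

/-- Tsai's wall at every factor implies the polyhedral DSS Liouville statement (drop the symmetry). -/
theorem dssLiouville_of_wall (hW : ∀ c : ℝ, TypeIDSSLiouville c) : PolyhedralTypeIDssLiouville :=
  fun _G _hG c hc u hanc hmeas hdss hdec _hequi => hW c hc u hanc hmeas hdss hdec

/-- The route's kill switch (item 1405, Type-I Liouville under polyhedral symmetry WITHOUT DSS)
implies the polyhedral DSS Liouville statement, via the landed support item 1408. -/
theorem dssLiouville_of_killSwitch (hK : QuantisedSymmetry.PolyhedralTypeILiouville) :
    PolyhedralTypeIDssLiouville :=
  liouville_iff_not_crux.2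
    (_root_.Summit.NavierStokesRegularity.NavierStokesRegularity.Theorems.quantisedSymmetry_liouvilleKillsProfile_proof
      hK)

/-- OBSTRUCTION NOTE for the negation / even-map hunt (typed, NOT a stub, not claimed proved here):
a `G`-equivariant free-space Beltrami field `B` (`div B = 0`, `curl B = κ B`, `|B| ≲ 1/(1+|x|)`,
e.g. `B = T + κ⁻¹ curl T`, `T = curl (x j_ℓ(κ|x|) Y_ℓm)` averaged over `G`) satisfies
`(B·∇)B = ∇(|B|²/2)`, hence `P ∇·(B ⊗ B) = 0`: the `s`-independent bilinear self-similar Duhamel form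
`𝔅(B, B)` vanishes although `B ≠ 0`.  Consequence: the even quadratic map `Q(V) = 𝔅(V, V)` of the
EVENMAP protocol has zeros on the unit sphere, `Q/‖Q‖` is undefined there, and no sphere-degree /
Borsuk–Ulam count of fixed points of `V ↦ 𝔅(V,V)` is available. -/
def EquivariantBeltramiZeroExists (G : Subgroup (E3 ≃ₗᵢ[ℝ] E3)) : Prop :=
  ∃ B : E3 → E3, ContDiff ℝ 2 B ∧ B ≠ 0 ∧ VectorCalculus.IsDivFree B ∧
    (∃ κ : ℝ, 0 < κ ∧ curl B = κ • B) ∧ (∃ C : ℝ, ∀ x, ‖B x‖ ≤ C / (1 + ‖x‖)) ∧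
    (∀ g ∈ G, ∀ x, B (g x) = g (B x)) ∧
    convect B B = gradient (fun x => ‖B x‖ ^ 2 / 2)

end Summit.NavierStokesRegularity.NavierStokesRegularity.Cruxes.PolyhedralDssProfileExists.StrategistS14g3
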